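import Literature.Geometry.DiscreteGeometry.KissingFanCensus
import HarnessLib

/-!
# The refined main estimate on the facets: one contact and two very long sides
# (Hales 2012, Theorem 2, case `d₃(1,0,2)`) and the refined budget inequality

Topic `Literature/Geometry/DiscreteGeometry`; provefact brick for `Hales2012_contactGraphTame`,
refining `KissingFacetPenalty.lean`.  There the constant of the main estimate for a fan triangle
with one contact side and a very long side (`⟪·,·⟫ < 0`, length `> 2√2` on `S²(2)`) is `0.36`,
which covers both of Hales's cases `(1,1,1)` and `(1,0,2)`.  For the census of contacts at
Hales's precision (`#contacts ≥ 23`, `KissingContactCount.lean`) the case `(1,0,2)` (one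
contact, BOTH other sides very long) must carry more: this file PROVES

* `sol0_add_le_sphExcess_of_one_contact_of_nonpos_of_nonpos`: **`E ≥ sol₀ + 0.49`** for a
  triangle with a contact side `⟪a, b⟫ = 1/2` and `⟪a, c⟫, ⟪b, c⟫ ∈ [−1/2, 0]` (corner
  principle on `[−1/2, 0]²`: least corner `F(0, 0, ½) = 1/2 ≥ 0.497 ≥ 1 − cos (sol₀ + 0.49)`;
  Hales prints `d₃(1,0,2) = 0.476` with his split at length `3.0`);
* `trianglePenaltyLB₂` (`= trianglePenaltyLB` except `0.49` in that case), its fan version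
  `fanPenaltyLB₂`, `fanPenaltyLB₂_le` (the main estimate per fan triangle) and the re-summed
  budget **`IsKissingConfig.sum_fanPenaltyLB₂_le_budget : Σ_c Σ_i fanPenaltyLB₂ ≤ 4π − 20 sol₀`**.

Everything is PROVED; no named facts.

## References
* T. C. Hales, arXiv:1209.6043 (2012), Theorem 2 (the function `d₃`, case `(1,0,2)`), Lemma 5.
  [`Hales2012`]
-/

noncomputable section

namespace Literature.Geometry.DiscreteGeometry

open Real RealInnerProductSpace Finset

/-! ### Part A. The case `(1,0,2)`: one contact, two very long sides -/

section Estimate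

local notation "E3" => EuclideanSpace ℝ (Fin 3)

variable {a b c : E3}

/-- **Case `(1,0,2)`: `E ≥ sol₀ + 0.49`** for a triangle with one contact edge `⟪a, b⟫ = 1/2`
whose two other edges are very long (`⟪a, c⟫, ⟪b, c⟫ ∈ [−1/2, 0]`, length `≥ 2√2` on
`S²(2)`).  Corner principle on the box `[−1/2, 0]²`: the least corner value is
`F(0, 0, ½) = 1/2 ≥ 0.497 ≥ 1 − cos (sol₀ + 0.49)`.
[cite: Hales2012, Theorem 2 (d₃(1,0,2) = 0.476)] -/
theorem sol0_add_le_sphExcess_of_one_contact_of_nonpos_of_nonpos (ha : ‖a‖ = 1) (hb : ‖b‖ = 1)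
    (hc : ‖c‖ = 1) (hli : LinearIndependent ℝ ![a, b, c]) (hab : ⟪a, b⟫ = 1 / 2)
    (hac : -1 / 2 ≤ ⟪a, c⟫ ∧ ⟪a, c⟫ ≤ 0) (hbc : -1 / 2 ≤ ⟪b, c⟫ ∧ ⟪b, c⟫ ≤ 0) :
    hales_sol0 + 0.49 ≤ sphExcess a b c := by
  apply le_sphExcess_of_one_sub_cos_le ha hb hc hli
    (by linarith [hales_sol0_le_pi_div_two, pi_gt_three])
  rw [hab]
  have hb := one_sub_cos_sol0_add_le (d := 0.49) (by norm_num) (by norm_num)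
  refine le_trans hb (le_trans (show _ ≤ (497 / 1000 : ℝ) by norm_num) ?_)
  refine le_eulerF_of_corners₂ (by norm_num) (by norm_num) (by norm_num) hbc hac ?_
  intro x' hx' y' hy'
  simp only [Set.mem_insert_iff, Set.mem_singleton_iff] at hx' hy'
  rcases hx' with rfl | rfl <;> rcases hy' with rfl | rfl <;> norm_num [eulerF, eulerGram]

/-- **The refined constant of the main estimate**: `trianglePenaltyLB`, except `0.49` (instead
of `0.36`) for exactly one contact side and two very long sides.
[cite: Hales2012, Theorem 2 (the function d₃)] -/
def trianglePenaltyLB₂ (x y z : ℝ) : ℝ :=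
  if contactCount x y z = 1 ∧ ((x < 0 ∧ y < 0) ∨ (x < 0 ∧ z < 0) ∨ (y < 0 ∧ z < 0)) then 0.49
  else trianglePenaltyLB x y z

/-- `trianglePenaltyLB₂` is nonnegative. [folklore] -/
theorem trianglePenaltyLB₂_nonneg (x y z : ℝ) : 0 ≤ trianglePenaltyLB₂ x y z := by
  unfold trianglePenaltyLB₂
  split_ifs
  · norm_num
  · exact trianglePenaltyLB_nonneg x y z

/-- `trianglePenaltyLB ≤ trianglePenaltyLB₂`. [folklore] -/
theorem trianglePenaltyLB_le_trianglePenaltyLB₂ (x y z : ℝ) :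
    trianglePenaltyLB x y z ≤ trianglePenaltyLB₂ x y z := by
  unfold trianglePenaltyLB₂
  split_ifs with h
  · rw [trianglePenaltyLB, if_neg (by rw [h.1]; norm_num), if_neg (by rw [h.1]; norm_num),
      if_pos h.1]
    split_ifs <;> norm_num
  · exact le_rfl

/-- **The refined main estimate for a triangle given by its side types**: under the hypotheses
of `le_sphExcess_sub_sol0_of_sides`, `trianglePenaltyLB₂ x y z ≤ sphExcess a b c − sol₀`.
[cite: Hales2012, Theorem 2 (A ≥ sol₀ + d₃(r,s,t))] -/
theorem le_sphExcess_sub_sol0_of_sides₂ (ha : ‖a‖ = 1) (hb : ‖b‖ = 1)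
    (hc : ‖c‖ = 1) (hli : LinearIndependent ℝ ![a, b, c])
    (hx : ⟪b, c⟫ = 1 / 2 ∨ (-1 / 2 ≤ ⟪b, c⟫ ∧ ⟪b, c⟫ ≤ 1031 / 5000))
    (hy : ⟪a, c⟫ = 1 / 2 ∨ (-1 / 2 ≤ ⟪a, c⟫ ∧ ⟪a, c⟫ ≤ 1031 / 5000))
    (hz : ⟪a, b⟫ = 1 / 2 ∨ (-1 / 2 ≤ ⟪a, b⟫ ∧ ⟪a, b⟫ ≤ 1031 / 5000))
    (hsum : -3 / 4 < ⟪b, c⟫ + ⟪a, c⟫ + ⟪a, b⟫)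
    (hix : ⟪a, c⟫ = 1 / 2 → ⟪a, b⟫ = 1 / 2 → -1 / 3 ≤ ⟪b, c⟫)
    (hiy : ⟪b, c⟫ = 1 / 2 → ⟪a, b⟫ = 1 / 2 → -1 / 3 ≤ ⟪a, c⟫)
    (hiz : ⟪b, c⟫ = 1 / 2 → ⟪a, c⟫ = 1 / 2 → -1 / 3 ≤ ⟪a, b⟫) :
    trianglePenaltyLB₂ ⟪b, c⟫ ⟪a, c⟫ ⟪a, b⟫ ≤ sphExcess a b c - hales_sol0 := by
  unfold trianglePenaltyLB₂
  split_ifs with h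
  · obtain ⟨hcc, hneg⟩ := h
    have hba : ⟪b, a⟫ = ⟪a, b⟫ := real_inner_comm a b
    have hca : ⟪c, a⟫ = ⟪a, c⟫ := real_inner_comm a c
    have hcb : ⟪c, b⟫ = ⟪b, c⟫ := real_inner_comm b c
    rcases hneg with ⟨h1, h2⟩ | ⟨h1, h2⟩ | ⟨h1, h2⟩
    · -- `bc`, `ac` very long; the contact must be `ab`: triangle `(a, b, c)`
      have hx' : ¬⟪b, c⟫ = 1 / 2 := fun h => by rw [h] at h1; norm_num at h1
      have hy' : ¬⟪a, c⟫ = 1 / 2 := fun h => by rw [h] at h2; norm_num at h2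
      rcases hz with hz | hz
      · have hxr : -1 / 2 ≤ ⟪b, c⟫ := (hx.resolve_left hx').1
        have hyr : -1 / 2 ≤ ⟪a, c⟫ := (hy.resolve_left hy').1
        have := sol0_add_le_sphExcess_of_one_contact_of_nonpos_of_nonpos ha hb hc hli hz
          ⟨hyr, h2.le⟩ ⟨hxr, h1.le⟩
        norm_num at this ⊢; linarith
      · have hz' : ¬⟪a, b⟫ = 1 / 2 := fun h => by rw [h] at hz; norm_num at hz
        rw [contactCount, if_neg hx', if_neg hy', if_neg hz'] at hcc
        exact absurd hcc (by norm_num)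
    · -- `bc`, `ab` very long; the contact must be `ac`: triangle `(a, c, b)`
      have hx' : ¬⟪b, c⟫ = 1 / 2 := fun h => by rw [h] at h1; norm_num at h1
      have hz' : ¬⟪a, b⟫ = 1 / 2 := fun h => by rw [h] at h2; norm_num at h2
      rcases hy with hy | hy
      · have hxr : -1 / 2 ≤ ⟪b, c⟫ := (hx.resolve_left hx').1
        have hzr : -1 / 2 ≤ ⟪a, b⟫ := (hz.resolve_left hz').1
        have hli' : LinearIndependent ℝ ![a, c, b] :=
          linearIndependent_triple_perm hli 0 2 1 (by decide) (by decide) (by decide)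
        have := sol0_add_le_sphExcess_of_one_contact_of_nonpos_of_nonpos ha hc hb hli' hy
          ⟨hzr, h2.le⟩ (by rw [hcb]; exact ⟨hxr, h1.le⟩)
        rw [sphExcess_swap₂₃] at this
        norm_num at this ⊢; linarith
      · have hy' : ¬⟪a, c⟫ = 1 / 2 := fun h => by rw [h] at hy; norm_num at hy
        rw [contactCount, if_neg hx', if_neg hy', if_neg hz'] at hcc
        exact absurd hcc (by norm_num)
    · -- `ac`, `ab` very long; the contact must be `bc`: triangle `(b, c, a)`
      have hy' : ¬⟪a, c⟫ = 1 / 2 := fun h => by rw [h] at h1; norm_num at h1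
      have hz' : ¬⟪a, b⟫ = 1 / 2 := fun h => by rw [h] at h2; norm_num at h2
      rcases hx with hx | hx
      · have hyr : -1 / 2 ≤ ⟪a, c⟫ := (hy.resolve_left hy').1
        have hzr : -1 / 2 ≤ ⟪a, b⟫ := (hz.resolve_left hz').1
        have hli' : LinearIndependent ℝ ![b, c, a] :=
          linearIndependent_triple_perm hli 1 2 0 (by decide) (by decide) (by decide)
        have := sol0_add_le_sphExcess_of_one_contact_of_nonpos_of_nonpos hb hc ha hli' hx
          (by rw [hba]; exact ⟨hzr, h2.le⟩) (by rw [hca]; exact ⟨hyr, h1.le⟩)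
        rw [sphExcess_rotate] at this
        norm_num at this ⊢; linarith
      · have hx' : ¬⟪b, c⟫ = 1 / 2 := fun h => by rw [h] at hx; norm_num at hx
        rw [contactCount, if_neg hx', if_neg hy', if_neg hz'] at hcc
        exact absurd hcc (by norm_num)
  · exact le_sphExcess_sub_sol0_of_sides ha hb hc hli hx hy hz hsum hix hiy hiz

end Estimate

/-! ### Part B. The refined constant on the fan triangles and the refined budget inequality -/

section Facets

local notation "E3" => EuclideanSpace ℝ (Fin 3)

variable {X : Finset E3}

/-- **The refined constant of the `i`-th fan triangle `(w 0, w (i+1), w (i+2))` of the facet of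
`c`** (`trianglePenaltyLB₂` of its side cosines). [cite: Hales2012, Theorem 2] -/
def fanPenaltyLB₂ (X : Finset E3) (c : E3) (i : ℕ) : ℝ :=
  trianglePenaltyLB₂ ⟪fVert X c (i + 1), fVert X c (i + 2)⟫ ⟪fVert X c 0, fVert X c (i + 2)⟫
    ⟪fVert X c 0, fVert X c (i + 1)⟫

/-- `fanPenaltyLB₂` is nonnegative. [folklore] -/
theorem fanPenaltyLB₂_nonneg (X : Finset E3) (c : E3) (i : ℕ) : 0 ≤ fanPenaltyLB₂ X c i :=
  trianglePenaltyLB₂_nonneg _ _ _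

/-- `fanPenaltyLB ≤ fanPenaltyLB₂`. [folklore] -/
theorem fanPenaltyLB_le_fanPenaltyLB₂ {c : E3} (hc : c ≠ 0) (i : ℕ) :
    fanPenaltyLB X c i ≤ fanPenaltyLB₂ X c i := by
  rw [fanPenaltyLB_eq hc]; exact trianglePenaltyLB_le_trianglePenaltyLB₂ _ _ _

/-- **The refined main estimate on a fan triangle of a facet**: for twelve unit vectors whose
distinct pairs have inner product `1/2` or `≤ κ₀`, a facet normal `c` and `i + 2 < m_c`, the
penalty `sphExcess − sol₀` of the fan triangle `(w 0, w (i+1), w (i+2))` is at least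
`fanPenaltyLB₂ X c i`. [cite: Hales2012, Theorem 2] -/
theorem fanPenaltyLB₂_le (h12 : X.card = 12) (hX1 : ∀ y ∈ X, ‖y‖ = 1)
    (hV : ∀ y ∈ X, ∀ y' ∈ X, y ≠ y' → ⟪y, y'⟫ = 1 / 2 ∨ ⟪y, y'⟫ ≤ 1031 / 5000)
    {c : E3} (hc : c ∈ facetNormals X) {i : ℕ} (hi : i + 2 < (tightSet X c).card) :
    fanPenaltyLB₂ X c i ≤
      sphExcess (fVert X c 0) (fVert X c (i + 1)) (fVert X c (i + 2)) - hales_sol0 := by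
  have hp : ∀ y ∈ X, ∀ y' ∈ X, y ≠ y' → ⟪y, y'⟫ ≤ 1 / 2 := fun y hy y' hy' h =>
    (hV y hy y' hy' h).elim le_of_eq fun h' => by linarith
  have hc0 := ne_zero_of_mem_facetNormals hX1 hc
  have hi' : i + 2 < (facetAngles X c hc0).card := by rwa [card_facetAngles hX1 hc0]
  unfold fanPenaltyLB₂
  rw [fVert_eq hc0, fVert_eq hc0, fVert_eq hc0]
  set w := facetVertex X c hc0 with hw
  have h0 : w 0 ∈ tightSet X c := facetVertex_mem hc0 (by omega)
  have h1 : w (i + 1) ∈ tightSet X c := facetVertex_mem hc0 (by omega)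
  have h2 : w (i + 2) ∈ tightSet X c := facetVertex_mem hc0 hi'
  have hu0 := hX1 _ (mem_tightSet.1 h0).1
  have hu1 := hX1 _ (mem_tightSet.1 h1).1
  have hu2 := hX1 _ (mem_tightSet.1 h2).1
  have hinj := facetVertex_injOn (X := X) hc0
  have hne01 : w 0 ≠ w (i + 1) := fun h => by
    have := hinj (Finset.mem_coe.2 (Finset.mem_range.2 (by omega)))
      (Finset.mem_coe.2 (Finset.mem_range.2 (by omega))) h
    omega
  have hne02 : w 0 ≠ w (i + 2) := fun h => by
    have := hinj (Finset.mem_coe.2 (Finset.mem_range.2 (by omega)))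
      (Finset.mem_coe.2 (Finset.mem_range.2 hi')) h
    omega
  have hne12 : w (i + 1) ≠ w (i + 2) := fun h => by
    have := hinj (Finset.mem_coe.2 (Finset.mem_range.2 (by omega)))
      (Finset.mem_coe.2 (Finset.mem_range.2 hi')) h
    omega
  have hor := orient3_facetVertex_pos hX1 hc (i := 0) (j := i + 1) (k := i + 2) (by omega)
    (by omega) hi'
  have hli : LinearIndependent ℝ ![w 0, w (i + 1), w (i + 2)] :=
    linearIndependent_of_orient3_ne_zero hor.ne'
  refine le_sphExcess_sub_sol0_of_sides₂ hu0 hu1 hu2 hli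
    (inner_cases_of_tight h12 hX1 hV hc h1 h2 hne12)
    (inner_cases_of_tight h12 hX1 hV hc h0 h2 hne02)
    (inner_cases_of_tight h12 hX1 hV hc h0 h1 hne01)
    (by linarith [sum_inner_gt_of_tight h12 hX1 hp hc h0 h1 h2])
    (fun ha hb => (neg_third_lt_inner_of_isosceles_tight h12 hX1 hp hc h0 h1 h2 hb ha hne12).le)
    (fun ha hb => ?_) (fun ha hb => ?_)
  · have hb' : ⟪w (i + 1), w 0⟫ = 1 / 2 := by rw [real_inner_comm]; exact hb
    exact (neg_third_lt_inner_of_isosceles_tight h12 hX1 hp hc h1 h0 h2 hb' ha hne02).le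
  · have ha' : ⟪w (i + 2), w (i + 1)⟫ = 1 / 2 := by rw [real_inner_comm]; exact ha
    have hb' : ⟪w (i + 2), w 0⟫ = 1 / 2 := by rw [real_inner_comm]; exact hb
    exact (neg_third_lt_inner_of_isosceles_tight h12 hX1 hp hc h2 h0 h1 hb' ha' hne01).le

/-- **The refined main estimate on a facet**: `Σ_i fanPenaltyLB₂ ≤ 4π · frac(c) − (m_c − 2) sol₀`.
[cite: Hales2012, Theorem 2 and Lemma 4] -/
theorem sum_fanPenaltyLB₂_le_facet_weight (h12 : X.card = 12) (hX1 : ∀ y ∈ X, ‖y‖ = 1)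
    (hV : ∀ y ∈ X, ∀ y' ∈ X, y ≠ y' → ⟪y, y'⟫ = 1 / 2 ∨ ⟪y, y'⟫ ≤ 1031 / 5000)
    (h0 : (0 : E3) ∈ interior (convexHull ℝ (X : Set E3))) {c : E3} (hc : c ∈ facetNormals X) :
    ∑ i ∈ range ((tightSet X c).card - 2), fanPenaltyLB₂ X c i ≤
      4 * π * ballFraction (0 : E3) (argmaxCone (facetNormals X) c) -
        ((tightSet X c).card - 2) * hales_sol0 := by
  have hc0 := ne_zero_of_mem_facetNormals hX1 hc
  set m := (facetAngles X c hc0).card with hm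
  have hmt : (tightSet X c).card = m := (card_facetAngles hX1 hc0).symm
  have hm3 : 3 ≤ m := by rw [← hmt]; exact three_le_card_tightSet hc
  have hw : ∀ i j k, i < j → j < k → k < m →
      0 < orient3 (facetVertex X c hc0 i) (facetVertex X c hc0 j) (facetVertex X c hc0 k) :=
    fun i j k hij hjk hk => orient3_facetVertex_pos hX1 hc hij hjk hk
  have hfan := sum_fan_angles_sub_pi_le hm3 hw
  rw [← argmaxCone_eq_polyCone hX1 h0 hc] at hfan
  rw [hmt]
  have hle : ∀ i ∈ range (m - 2), fanPenaltyLB₂ X c i ≤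
      sphExcess (facetVertex X c hc0 0) (facetVertex X c hc0 (i + 1))
        (facetVertex X c hc0 (i + 2)) - hales_sol0 := fun i hi => by
    have := fanPenaltyLB₂_le h12 hX1 hV hc (i := i)
      (by rw [hmt]; have := mem_range.1 hi; omega)
    rwa [fVert_eq hc0, fVert_eq hc0, fVert_eq hc0] at this
  have hsum := Finset.sum_le_sum hle
  rw [Finset.sum_sub_distrib, Finset.sum_const, Finset.card_range, nsmul_eq_mul] at hsum
  have hex : ∑ i ∈ range (m - 2), sphExcess (facetVertex X c hc0 0)
      (facetVertex X c hc0 (i + 1)) (facetVertex X c hc0 (i + 2)) ≤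
      4 * π * ballFraction (0 : E3) (argmaxCone (facetNormals X) c) := by
    simpa only [sphExcess] using hfan
  have hcast : ((m - 2 : ℕ) : ℝ) = (m : ℝ) - 2 := by
    rw [Nat.cast_sub (by omega)]; norm_num
  rw [hcast] at hsum
  linarith

/-- **The refined budget inequality**: `Σ_c Σ_i fanPenaltyLB₂ ≤ 4π − 20 sol₀`.
[cite: Hales2012, Lemma 5 and Theorem 3 (proof, weights)] -/
theorem sum_sum_fanPenaltyLB₂_le (h12 : X.card = 12) (hX1 : ∀ y ∈ X, ‖y‖ = 1)
    (hV : ∀ y ∈ X, ∀ y' ∈ X, y ≠ y' → ⟪y, y'⟫ = 1 / 2 ∨ ⟪y, y'⟫ ≤ 1031 / 5000) :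
    ∑ c ∈ facetNormals X, ∑ i ∈ range ((tightSet X c).card - 2), fanPenaltyLB₂ X c i ≤
      4 * π - 20 * hales_sol0 := by
  have hp : ∀ y ∈ X, ∀ y' ∈ X, y ≠ y' → ⟪y, y'⟫ ≤ 1 / 2 := fun y hy y' hy' h =>
    (hV y hy y' hy' h).elim le_of_eq fun h' => by linarith
  have h0 := zero_mem_interior_convexHull_of_twelve_unit h12 hX1 hp
  rw [← sum_facet_weight_eq h12 hX1 h0]
  exact Finset.sum_le_sum fun c hc => sum_fanPenaltyLB₂_le_facet_weight h12 hX1 hV h0 hc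

variable {S : Set E3}

/-- **The refined budget inequality for `V ∈ 𝒱`**: `Σ fanPenaltyLB₂ (V/2) ≤ 4π − 20 sol₀`.
[cite: Hales2012, Lemma 5 and Theorem 2] -/
theorem IsKissingConfig.sum_fanPenaltyLB₂_le_budget (hS : IsKissingConfig S) :
    ∑ c ∈ facetNormals hS.unitConfig,
        ∑ i ∈ range ((tightSet hS.unitConfig c).card - 2), fanPenaltyLB₂ hS.unitConfig c i ≤
      4 * π - 20 * hales_sol0 :=
  sum_sum_fanPenaltyLB₂_le hS.card_unitConfig (fun _ hy => hS.norm_of_mem_unitConfig hy)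
    fun _ hy _ hy' hne => hS.inner_of_mem_unitConfig hy hy' hne

end Facets

end Literature.Geometry.DiscreteGeometry

end
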